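import Literature.Barriers.QuantumFields.FiniteTemperatureDeconfinement
import Literature.MathematicalPhysics.QuantumFieldTheory.StrongCouplingActivities
import Literature.MathematicalPhysics.QuantumFieldTheory.LatticeRPMechanism
import HarnessLib

/-!
# The time reflection of the finite-temperature lattice `ℤ_{L₀} × (ℤ/L)^d`

Bookkeeping for the reflection-positivity proof of Borgs–Seiler's diagonal bound
`G_L(0) = ⟨|Tr u|²⟩ ≥ 1` ((III.18)/(III.23) of Commun. Math. Phys. 91 (1983) 329; the named fact
`Literature.Barriers.QuantumFields.BorgsSeilerPolyakovDiagonal`), in the setting of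
`Literature.Barriers.QuantumFields.FiniteTemperatureDeconfinement` (configurations
`FiniteTemperature.Config d L₀ L G` on the links of `ℤ_{L₀} × (ℤ/L)^d`, Wilson weight
`FiniteTemperature.weight ρ J_E J_M`). Everything here is proved; no facts, no physics input
beyond the definitions of that file.

* `FiniteTemperature.timeReflect` — the time reflection `θ t = −t` on configurations: spatial
  links `((t, x), i) ↦ U((−t, x), i)`, time-like links `((t, x), time) ↦ U((−1−t, x), time)⁻¹`
  (the link from `−1−t` to `−t` traversed backwards). It is an involution
  (`timeReflect_timeReflect`) and preserves the a-priori measure `∏ dg`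
  (`measurePreserving_timeReflect`: a permutation of the Haar factors followed by inversion of
  the time-like ones; inversion invariance of the Haar probability measure of a compact group is
  the tree's `haarProbability.instIsInvInvariant`).
* Plaquettes and the action under the reflection: spatial plaquettes are carried to spatial
  plaquettes of the reflected slice (`plaquette_timeReflect_some_some`), time-like plaquettes
  between the slices `t, t+1` to conjugate-inverses of the time-like plaquettes between
  `−1−t, −t` (`plaquette_timeReflect_none_some`), so for a unitary representation the slice sums
  `magSlice`, `elecSlice` of `Re tr ρ(U_P)` satisfy `magSlice t (θU) = magSlice (−t) U`,
  `elecSlice t (θU) = elecSlice (−1−t) U`, and `minusAction = J_E Σ_t elecSlice t + J_M Σ_t magSlice t`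
  (`minusAction_eq_sum_slices`).
* Time-like holonomies: `timeHolonomy_add` (concatenation), `timeHolonomy_succ_right`, and
  `timeHolonomy_timeReflect : timeHolonomy (θU) n (t, x) = (timeHolonomy U n (−t−n, x))⁻¹` — the
  reflection carries the first half of a Polyakov loop to the inverse of its second half.
* `rep_inv_eq_star` — `ρ(g⁻¹) = ρ(g)ᴴ` for a unitary matrix representation, and the real parts
  of traces of inverse plaquettes.

References: C. Borgs, E. Seiler, Commun. Math. Phys. 91 (1983) 329–380, §II.2 (transfer matrix,
reflection positivity "with respect to reflection both in lattice planes and in planes lying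
half-way between lattice planes", pp. 331–332) and §III.1 (III.25) (p. 347); K. Osterwalder,
E. Seiler, Ann. Phys. 110 (1978) 440, §2. [BorgsSeiler1983]
-/

noncomputable section

open MeasureTheory Filter Topology
open scoped ComplexConjugate

namespace Literature.Barriers.QuantumFields

namespace FiniteTemperature

variable {d L₀ L : ℕ} {G : Type*} [Group G] {N : ℕ}

/-! ### Time-like holonomies: concatenation -/

/-- Appending one link at the end of a time-like path. [folklore] -/
theorem timeHolonomy_succ_right (U : Config d L₀ L G) (n : ℕ) (t : ZMod L₀) (x : Fin d → ZMod L) :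
    timeHolonomy U (n + 1) (t, x) = timeHolonomy U n (t, x) * U ((t + n, x), none) := by
  induction n generalizing t with
  | zero => simp [timeHolonomy]
  | succ n ih =>
      have hc : (t + 1 + (n : ZMod L₀)) = t + ((n + 1 : ℕ) : ZMod L₀) := by push_cast; ring
      calc timeHolonomy U (n + 1 + 1) (t, x)
          = U ((t, x), none) * timeHolonomy U (n + 1) (t + 1, x) := rfl
        _ = U ((t, x), none) * (timeHolonomy U n (t + 1, x) * U ((t + 1 + n, x), none)) := by
            rw [ih]
        _ = U ((t, x), none) * timeHolonomy U n (t + 1, x) * U ((t + ((n + 1 : ℕ) : ZMod L₀), x),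
              none) := by rw [mul_assoc, hc]
        _ = timeHolonomy U (n + 1) (t, x) * U ((t + ((n + 1 : ℕ) : ZMod L₀), x), none) := rfl

/-- Concatenation of time-like paths: `n + k` steps from `(t, x)` are `n` steps from `(t, x)`
followed by `k` steps from `(t + n, x)`. [folklore] -/
theorem timeHolonomy_add (U : Config d L₀ L G) (n k : ℕ) (t : ZMod L₀) (x : Fin d → ZMod L) :
    timeHolonomy U (n + k) (t, x) = timeHolonomy U n (t, x) * timeHolonomy U k (t + n, x) := by
  induction k with
  | zero => simp [timeHolonomy]
  | succ k ih =>
      have hc : (t + ((n + k : ℕ) : ZMod L₀)) = t + n + k := by push_cast; ring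
      calc timeHolonomy U (n + (k + 1)) (t, x) = timeHolonomy U (n + k + 1) (t, x) := rfl
        _ = timeHolonomy U n (t, x) * timeHolonomy U k (t + n, x) * U ((t + n + k, x), none) := by
            rw [timeHolonomy_succ_right, ih, hc]
        _ = timeHolonomy U n (t, x) * timeHolonomy U (k + 1) (t + n, x) := by
            rw [timeHolonomy_succ_right, mul_assoc]

/-! ### The time reflection -/

/-- The time reflection `θ t = −t` on (positively oriented) links: a spatial link at time `t`
goes to the same spatial link at time `−t`; the time-like link from `t` to `t + 1` goes to the
time-like link from `−1−t` to `−t` (to be traversed backwards). [cite: BorgsSeiler1983, §II.2 (pp. 331–332)] -/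
def reflectLink : Site d L₀ L × Dir d → Site d L₀ L × Dir d
  | ((t, x), some i) => ((-t, x), some i)
  | ((t, x), none) => ((-1 - t, x), none)

omit [Group G] in
/-- `reflectLink` on spatial links. [folklore] -/
@[simp] theorem reflectLink_some (t : ZMod L₀) (x : Fin d → ZMod L) (i : Fin d) :
    reflectLink (((t, x), some i) : Site d L₀ L × Dir d) = ((-t, x), some i) := rfl

omit [Group G] in
/-- `reflectLink` on time-like links. [folklore] -/
@[simp] theorem reflectLink_none (t : ZMod L₀) (x : Fin d → ZMod L) :
    reflectLink (((t, x), none) : Site d L₀ L × Dir d) = ((-1 - t, x), none) := rfl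

omit [Group G] in
/-- `reflectLink` is an involution. [folklore] -/
theorem reflectLink_reflectLink (e : Site d L₀ L × Dir d) : reflectLink (reflectLink e) = e := by
  rcases e with ⟨⟨t, x⟩, _ | i⟩
  · simp only [reflectLink_none]
    congr 2; ring
  · simp only [reflectLink_some, neg_neg]

/-- `reflectLink` as a permutation of the links. [folklore] -/
def reflectLinkEquiv : Equiv.Perm (Site d L₀ L × Dir d) where
  toFun := reflectLink
  invFun := reflectLink
  left_inv := reflectLink_reflectLink
  right_inv := reflectLink_reflectLink

/-- **The time reflection on configurations**: `(θU)(e) = U(θe)` for spatial links and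
`(θU)(e) = U(θe)⁻¹` for time-like links. [cite: BorgsSeiler1983, §II.2 (pp. 331–332)] -/
def timeReflect (U : Config d L₀ L G) : Config d L₀ L G
  | ((t, x), some i) => U ((-t, x), some i)
  | ((t, x), none) => (U ((-1 - t, x), none))⁻¹

/-- `timeReflect` on spatial links. [folklore] -/
@[simp] theorem timeReflect_some (U : Config d L₀ L G) (t : ZMod L₀) (x : Fin d → ZMod L)
    (i : Fin d) : timeReflect U ((t, x), some i) = U ((-t, x), some i) := rfl

/-- `timeReflect` on time-like links. [folklore] -/
@[simp] theorem timeReflect_none (U : Config d L₀ L G) (t : ZMod L₀) (x : Fin d → ZMod L) :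
    timeReflect U ((t, x), none) = (U ((-1 - t, x), none))⁻¹ := rfl

/-- The time reflection is an involution. [folklore] -/
theorem timeReflect_timeReflect (U : Config d L₀ L G) : timeReflect (timeReflect U) = U := by
  funext e
  rcases e with ⟨⟨t, x⟩, _ | i⟩
  · simp only [timeReflect_none, inv_inv]
    congr 3; ring
  · simp only [timeReflect_some, neg_neg]

/-- Coordinatewise inversion of the time-like link variables. [folklore] -/
def invTemporal (e : Site d L₀ L × Dir d) (g : G) : G := if e.2 = none then g⁻¹ else g

/-- `timeReflect` = relabelling by `reflectLink` followed by inversion of the time-like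
coordinates. [folklore] -/
theorem timeReflect_eq (U : Config d L₀ L G) :
    timeReflect U = fun e => invTemporal e (U (reflectLink e)) := by
  funext e
  rcases e with ⟨⟨t, x⟩, _ | i⟩
  · simp [invTemporal]
  · simp [invTemporal]

variable [TopologicalSpace G] [IsTopologicalGroup G] [CompactSpace G] [MeasurableSpace G]
  [BorelSpace G]

omit [TopologicalSpace G] [IsTopologicalGroup G] [CompactSpace G] [BorelSpace G] [Group G] in
/-- Relabelling by `reflectLink` as a measurable equivalence. [folklore] -/
def reflectRelabelEquiv : Config d L₀ L G ≃ᵐ Config d L₀ L G :=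
  MeasurableEquiv.piCongrLeft (fun _ : Site d L₀ L × Dir d => G) reflectLinkEquiv.symm

omit [TopologicalSpace G] [IsTopologicalGroup G] [CompactSpace G] [BorelSpace G] [Group G] in
/-- The relabelling equivalence is `U ↦ U ∘ reflectLink`. [folklore] -/
theorem coe_reflectRelabelEquiv :
    ⇑(reflectRelabelEquiv (d := d) (L₀ := L₀) (L := L) (G := G)) = fun U e => U (reflectLink e) := by
  funext U; funext e
  rw [reflectRelabelEquiv, MeasurableEquiv.coe_piCongrLeft, Equiv.piCongrLeft_apply_eq_cast,
    cast_eq]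
  rfl

/-- **The time reflection preserves the a-priori measure** `∏ dg` (a permutation of the factors,
then inversion of the time-like ones; the Haar probability measure of a compact group is
inversion invariant, `haarProbability.instIsInvInvariant`). [folklore] -/
theorem measurePreserving_timeReflect [NeZero L₀] [NeZero L] :
    MeasurePreserving (timeReflect (G := G)) (haar d L₀ L G) (haar d L₀ L G) := by
  have h1 : MeasurePreserving (reflectRelabelEquiv (d := d) (L₀ := L₀) (L := L) (G := G))
      (haar d L₀ L G) (haar d L₀ L G) :=
    measurePreserving_piCongrLeft
      (fun _ : Site d L₀ L × Dir d =>
        Literature.MathematicalPhysics.QuantumFieldTheory.haarProbability G)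
      reflectLinkEquiv.symm
  have h2 : MeasurePreserving (fun (V : Config d L₀ L G) e => invTemporal e (V e))
      (haar d L₀ L G) (haar d L₀ L G) := by
    unfold haar
    refine measurePreserving_pi _ _ fun e => ?_
    by_cases he : e.2 = none
    · have : invTemporal (G := G) e = Inv.inv := by funext g; simp [invTemporal, he]
      rw [this]
      exact Measure.measurePreserving_inv _
    · have : invTemporal (G := G) e = id := by funext g; simp [invTemporal, he]
      rw [this]
      exact MeasurePreserving.id _
  have h := h2.comp h1
  have hcomp : (fun (V : Config d L₀ L G) e => invTemporal e (V e)) ∘ ⇑reflectRelabelEquiv =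
      timeReflect := by
    funext U
    rw [Function.comp_apply, coe_reflectRelabelEquiv, timeReflect_eq]
  rwa [hcomp] at h

/-! ### Plaquettes and the action under the reflection -/

omit [TopologicalSpace G] [IsTopologicalGroup G] [CompactSpace G] [MeasurableSpace G]
  [BorelSpace G] in
/-- Spatial plaquettes of the reflected configuration are the spatial plaquettes of the
reflected slice. [folklore] -/
theorem plaquette_timeReflect_some_some (U : Config d L₀ L G) (t : ZMod L₀) (x : Fin d → ZMod L)
    (i j : Fin d) :
    plaquette (timeReflect U) (t, x) (some i) (some j) = plaquette U (-t, x) (some i) (some j) := by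
  simp [plaquette, Site.shift]

omit [TopologicalSpace G] [IsTopologicalGroup G] [CompactSpace G] [MeasurableSpace G]
  [BorelSpace G] in
/-- Time-like plaquettes of the reflected configuration: the plaquette between the slices
`t, t+1` of `θU` at `(x, i)` is `a⁻¹ P⁻¹ a`, where `P` is the plaquette of `U` between the slices
`−1−t, −t` at `(x, i)` and `a` its first link. [folklore] -/
theorem plaquette_timeReflect_none_some (U : Config d L₀ L G) (t : ZMod L₀) (x : Fin d → ZMod L)
    (i : Fin d) :
    plaquette (timeReflect U) (t, x) none (some i) =
      (U ((-1 - t, x), none))⁻¹ * (plaquette U (-1 - t, x) none (some i))⁻¹ *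
        U ((-1 - t, x), none) := by
  simp only [plaquette, Site.shift, timeReflect_none, timeReflect_some, inv_inv, mul_inv_rev,
    mul_assoc]
  have h1 : (-1 - (t + 1) : ZMod L₀) = -1 - t + -1 := by ring
  have h2 : (-(t + 1) : ZMod L₀) = -1 - t := by ring
  have h3 : (-1 - t + 1 : ZMod L₀) = -t := by ring
  rw [h2, h3]
  simp

variable (ρ : G →* Matrix (Fin N) (Fin N) ℂ)

omit [TopologicalSpace G] [IsTopologicalGroup G] [CompactSpace G] [MeasurableSpace G]
  [BorelSpace G] in
/-- For a unitary matrix representation, `ρ(g⁻¹) = ρ(g)ᴴ`. [folklore] -/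
theorem rep_inv_eq_star (hρu : ∀ g, ρ g ∈ Matrix.unitaryGroup (Fin N) ℂ) (g : G) :
    ρ g⁻¹ = star (ρ g) := by
  have h1 : ρ g⁻¹ * ρ g = 1 := by rw [← map_mul, inv_mul_cancel, map_one]
  calc ρ g⁻¹ = ρ g⁻¹ * (ρ g * star (ρ g)) := by rw [Unitary.mul_star_self_of_mem (hρu g), mul_one]
    _ = star (ρ g) := by rw [← mul_assoc, h1, one_mul]

omit [TopologicalSpace G] [IsTopologicalGroup G] [CompactSpace G] [MeasurableSpace G]
  [BorelSpace G] in
/-- `Re tr ρ(g⁻¹) = Re tr ρ(g)` for a unitary representation. [folklore] -/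
theorem trace_re_rep_inv (hρu : ∀ g, ρ g ∈ Matrix.unitaryGroup (Fin N) ℂ) (g : G) :
    (ρ g⁻¹).trace.re = (ρ g).trace.re := by
  rw [rep_inv_eq_star ρ hρu, Matrix.star_eq_conjTranspose, Matrix.trace_conjTranspose,
    Complex.star_def, Complex.conj_re]

omit [TopologicalSpace G] [IsTopologicalGroup G] [CompactSpace G] [MeasurableSpace G]
  [BorelSpace G] in
/-- `Re tr ρ(a⁻¹ g a) = Re tr ρ(g)`. [folklore] -/
theorem trace_re_rep_conj (a g : G) : (ρ (a⁻¹ * g * a)).trace.re = (ρ g).trace.re := by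
  rw [map_mul, map_mul, Matrix.trace_mul_cycle, ← map_mul, mul_inv_cancel, map_one, one_mul]

/-- The "magnetic" slice sum: `Σ_{x} Σ_{i<j} Re tr ρ(U_P)` over the spatial plaquettes of the
time slice `t`. [cite: BorgsSeiler1983, §II.3 (II.20) (pp. 335–336)] -/
def magSlice [NeZero L] (t : ZMod L₀) (U : Config d L₀ L G) : ℝ :=
  ∑ x : Fin d → ZMod L, ∑ p : {p : Fin d × Fin d // p.1 < p.2},
    (ρ (plaquette U (t, x) (some p.1.1) (some p.1.2))).trace.re

/-- The "electric" slice sum: `Σ_{x} Σ_{i} Re tr ρ(U_P)` over the time-like plaquettes between the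
slices `t` and `t + 1`. [cite: BorgsSeiler1983, §II.3 (II.20) (pp. 335–336); §III.1 (III.1) (p. 344)] -/
def elecSlice [NeZero L] (t : ZMod L₀) (U : Config d L₀ L G) : ℝ :=
  ∑ x : Fin d → ZMod L, ∑ i : Fin d, (ρ (plaquette U (t, x) none (some i))).trace.re

omit [TopologicalSpace G] [IsTopologicalGroup G] [CompactSpace G] [MeasurableSpace G]
  [BorelSpace G] in
/-- The action as a sum over time slices. [folklore] -/
theorem minusAction_eq_sum_slices [NeZero L₀] [NeZero L] (JE JM : ℝ) (U : Config d L₀ L G) :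
    minusAction ρ JE JM U = JE * ∑ t : ZMod L₀, elecSlice ρ t U + JM * ∑ t : ZMod L₀, magSlice ρ t U := by
  unfold minusAction elecSlice magSlice
  rw [Fintype.sum_prod_type, Fintype.sum_prod_type]

omit [TopologicalSpace G] [IsTopologicalGroup G] [CompactSpace G] [MeasurableSpace G]
  [BorelSpace G] in
/-- The magnetic slice sums under the reflection: `magSlice t (θU) = magSlice (−t) U`. [folklore] -/
theorem magSlice_timeReflect [NeZero L] (t : ZMod L₀) (U : Config d L₀ L G) :
    magSlice ρ t (timeReflect U) = magSlice ρ (-t) U := by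
  unfold magSlice
  simp_rw [plaquette_timeReflect_some_some]

omit [TopologicalSpace G] [IsTopologicalGroup G] [CompactSpace G] [MeasurableSpace G]
  [BorelSpace G] in
/-- The electric slice sums under the reflection (unitary `ρ`):
`elecSlice t (θU) = elecSlice (−1−t) U`. [folklore] -/
theorem elecSlice_timeReflect [NeZero L] (hρu : ∀ g, ρ g ∈ Matrix.unitaryGroup (Fin N) ℂ)
    (t : ZMod L₀) (U : Config d L₀ L G) :
    elecSlice ρ t (timeReflect U) = elecSlice ρ (-1 - t) U := by
  unfold elecSlice
  refine Finset.sum_congr rfl fun x _ => Finset.sum_congr rfl fun i _ => ?_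
  rw [plaquette_timeReflect_none_some, trace_re_rep_conj, trace_re_rep_inv ρ hρu]

/-! ### Time-like holonomies under the reflection -/

omit [TopologicalSpace G] [IsTopologicalGroup G] [CompactSpace G] [MeasurableSpace G]
  [BorelSpace G] in
/-- **The reflection carries a time-like path to the inverse of the reflected path**:
`timeHolonomy (θU) n (t, x) = (timeHolonomy U n (−t−n, x))⁻¹`. In particular the first half of
a Polyakov loop goes to the inverse of its second half. [folklore] -/
theorem timeHolonomy_timeReflect (U : Config d L₀ L G) (n : ℕ) (t : ZMod L₀) (x : Fin d → ZMod L) :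
    timeHolonomy (timeReflect U) n (t, x) = (timeHolonomy U n (-t - n, x))⁻¹ := by
  induction n generalizing t with
  | zero => simp [timeHolonomy]
  | succ n ih =>
      have e1 : (-(t + 1) - (n : ZMod L₀)) = -t - ((n + 1 : ℕ) : ZMod L₀) := by push_cast; ring
      have e2 : (-1 - t : ZMod L₀) = -t - ((n + 1 : ℕ) : ZMod L₀) + n := by push_cast; ring
      calc timeHolonomy (timeReflect U) (n + 1) (t, x)
          = timeReflect U ((t, x), none) * timeHolonomy (timeReflect U) n (t + 1, x) := rfl
        _ = (U ((-1 - t, x), none))⁻¹ * (timeHolonomy U n (-(t + 1) - n, x))⁻¹ := by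
            rw [timeReflect_none, ih]
        _ = (timeHolonomy U n (-(t + 1) - n, x) * U ((-1 - t, x), none))⁻¹ := by rw [mul_inv_rev]
        _ = (timeHolonomy U (n + 1) (-t - ((n + 1 : ℕ) : ZMod L₀), x))⁻¹ := by
            rw [timeHolonomy_succ_right, e1, ← e2]


/-! ### Matrix algebra: traces against unitary matrices -/

omit [TopologicalSpace G] [IsTopologicalGroup G] [CompactSpace G] [MeasurableSpace G]
  [BorelSpace G] [Group G] in
/-- `tr(Dᴴ M) = Σ_{k,l} conj(D_{kl}) M_{kl}` (the Hilbert–Schmidt pairing). [folklore] -/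
theorem trace_star_mul_eq_sum (D M : Matrix (Fin N) (Fin N) ℂ) :
    (star D * M).trace = ∑ k, ∑ l, conj (D k l) * M k l := by
  rw [Matrix.trace, Finset.sum_comm]
  refine Finset.sum_congr rfl fun k _ => ?_
  rw [Matrix.diag_apply, Matrix.mul_apply]
  refine Finset.sum_congr rfl fun l _ => ?_
  rw [Matrix.star_apply, Complex.star_def]

omit [TopologicalSpace G] [IsTopologicalGroup G] [CompactSpace G] [MeasurableSpace G]
  [BorelSpace G] [Group G] in
/-- The columns of a unitary matrix have unit norm: `Σ_{k,i} |a_{ki}|² = N`. [folklore] -/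
theorem sum_sum_conj_mul_self_of_unitary {a : Matrix (Fin N) (Fin N) ℂ}
    (ha : a ∈ Matrix.unitaryGroup (Fin N) ℂ) : ∑ k, ∑ i, conj (a k i) * a k i = (N : ℂ) := by
  have h : (star a * a).trace = (N : ℂ) := by
    rw [Unitary.star_mul_self_of_mem ha, Matrix.trace_one, Fintype.card_fin]
  rw [trace_star_mul_eq_sum] at h
  exact h

omit [TopologicalSpace G] [IsTopologicalGroup G] [CompactSpace G] [MeasurableSpace G]
  [BorelSpace G] [Group G] in
/-- **The `|tr|² − 1` identity.** For unitary `N × N` matrices `a, b` (`N ≥ 1`),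
`|tr(aᴴ b)|² − 1 = Σ_{p,q} conj(F_{pq}(a)) F_{pq}(b)` with
`F_{pq}(a) = a_p conj(a_q) − δ_{pq}/N` (`p, q` pairs of indices): the character `|tr|² − 1` of
the representation on trace-free matrices is a positive-definite function, written as an
explicit sum of products of matrix coefficients — the form in which reflection positivity
applies to it (Borgs–Seiler: "`|Tr u|² = 1 + Σ cᵢ χᵢ(u)` … and the fact that by reflection
positivity `⟨χᵢ(u)⟩ ≥ 0`"). [cite: BorgsSeiler1983, §III.1 (III.25) (p. 347)] -/
theorem normSq_trace_sub_one_eq_sum {a b : Matrix (Fin N) (Fin N) ℂ}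
    (ha : a ∈ Matrix.unitaryGroup (Fin N) ℂ) (hb : b ∈ Matrix.unitaryGroup (Fin N) ℂ) (hN : N ≠ 0) :
    (((‖(star a * b).trace‖ ^ 2 : ℝ) : ℂ) - 1) =
      ∑ p : Fin N × Fin N, ∑ q : Fin N × Fin N,
        conj (a p.1 p.2 * conj (a q.1 q.2) - if p = q then ((N : ℂ))⁻¹ else 0) *
          (b p.1 p.2 * conj (b q.1 q.2) - if p = q then ((N : ℂ))⁻¹ else 0) := by
  classical
  -- the trace as a flattened Hilbert–Schmidt pairing
  set T : ℂ := ∑ p : Fin N × Fin N, conj (a p.1 p.2) * b p.1 p.2 with hT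
  have htr : (star a * b).trace = T := by
    rw [trace_star_mul_eq_sum, hT, Fintype.sum_prod_type]
  have hNa : ∑ p : Fin N × Fin N, conj (a p.1 p.2) * a p.1 p.2 = (N : ℂ) := by
    rw [Fintype.sum_prod_type]; exact sum_sum_conj_mul_self_of_unitary ha
  have hNb : ∑ p : Fin N × Fin N, conj (b p.1 p.2) * b p.1 p.2 = (N : ℂ) := by
    rw [Fintype.sum_prod_type]; exact sum_sum_conj_mul_self_of_unitary hb
  have hNc : (N : ℂ) ≠ 0 := Nat.cast_ne_zero.2 hN
  have hcard : (Fintype.card (Fin N × Fin N) : ℂ) = (N : ℂ) * N := by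
    rw [Fintype.card_prod, Fintype.card_fin]; push_cast; ring
  -- expand the product
  have hexp : ∀ p q : Fin N × Fin N,
      conj (a p.1 p.2 * conj (a q.1 q.2) - if p = q then ((N : ℂ))⁻¹ else 0) *
          (b p.1 p.2 * conj (b q.1 q.2) - if p = q then ((N : ℂ))⁻¹ else 0) =
        (conj (a p.1 p.2) * b p.1 p.2) * (a q.1 q.2 * conj (b q.1 q.2)) -
          (if p = q then ((N : ℂ))⁻¹ * (conj (a p.1 p.2) * a q.1 q.2) else 0) -
          (if p = q then ((N : ℂ))⁻¹ * (conj (b q.1 q.2) * b p.1 p.2) else 0) +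
          (if p = q then ((N : ℂ))⁻¹ * ((N : ℂ))⁻¹ else 0) := by
    intro p q
    split_ifs with h
    · simp only [map_sub, map_mul, Complex.conj_conj, map_inv₀, map_natCast]; ring
    · simp only [map_mul, Complex.conj_conj, sub_zero, add_zero]; ring
  simp_rw [hexp, Finset.sum_add_distrib, Finset.sum_sub_distrib, Finset.sum_ite_eq,
    Finset.mem_univ, if_true]
  rw [← Finset.sum_mul_sum, ← Finset.mul_sum, ← Finset.mul_sum, hNa, Finset.sum_const,
    Finset.card_univ, nsmul_eq_mul, hcard]
  have hTc : ∑ q : Fin N × Fin N, a q.1 q.2 * conj (b q.1 q.2) = conj T := by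
    rw [hT, map_sum]
    refine Finset.sum_congr rfl fun q _ => ?_
    rw [map_mul, Complex.conj_conj, mul_comm]
  rw [hNb, hTc, ← hT, ← htr, Complex.mul_conj, Complex.normSq_eq_norm_sq]
  field_simp
  push_cast
  ring

/-! ### Randomising a block of link variables -/

omit [TopologicalSpace G] [IsTopologicalGroup G] [CompactSpace G] [MeasurableSpace G]
  [BorelSpace G] in
/-- Left-multiply the link variables in `C` by the corresponding coordinates of `Y`. [folklore] -/
def mulOn (C : Finset (Site d L₀ L × Dir d)) (Y U : Config d L₀ L G) : Config d L₀ L G :=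
  fun e => (if e ∈ C then Y e else 1) * U e

omit [TopologicalSpace G] [IsTopologicalGroup G] [CompactSpace G] [MeasurableSpace G]
  [BorelSpace G] in
/-- `mulOn` on a link of `C`. [folklore] -/
theorem mulOn_apply_of_mem {C : Finset (Site d L₀ L × Dir d)} {e : Site d L₀ L × Dir d}
    (he : e ∈ C) (Y U : Config d L₀ L G) : mulOn C Y U e = Y e * U e := by
  simp [mulOn, he]

omit [TopologicalSpace G] [IsTopologicalGroup G] [CompactSpace G] [MeasurableSpace G]
  [BorelSpace G] in
/-- `mulOn` off `C`. [folklore] -/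
theorem mulOn_apply_of_not_mem {C : Finset (Site d L₀ L × Dir d)} {e : Site d L₀ L × Dir d}
    (he : e ∉ C) (Y U : Config d L₀ L G) : mulOn C Y U e = U e := by
  simp [mulOn, he]

variable [SecondCountableTopology G]

omit ρ [SecondCountableTopology G] in
/-- For fixed `Y`, `U ↦ mulOn C Y U` preserves the a-priori measure (left invariance of Haar
measure, factor by factor). [folklore] -/
theorem measurePreserving_mulOn [NeZero L₀] [NeZero L] (C : Finset (Site d L₀ L × Dir d))
    (Y : Config d L₀ L G) : MeasurePreserving (mulOn C Y) (haar d L₀ L G) (haar d L₀ L G) := by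
  unfold haar mulOn
  exact measurePreserving_pi _ _ fun e => measurePreserving_mul_left _ _

omit ρ in
/-- **Randomisation of a block.** For a bounded measurable `F`,
`∫ F dμ = ∫∫ F(mulOn C Y U) dμ(U) dμ(Y)`, written as an integral over `μ ⊗ μ` in the pair
`(U, Y)`. [folklore] -/
theorem integral_eq_integral_prod_mulOn [NeZero L₀] [NeZero L] (C : Finset (Site d L₀ L × Dir d))
    {F : Config d L₀ L G → ℂ} (hFm : Measurable F) {K : ℝ} (hFb : ∀ U, ‖F U‖ ≤ K) :
    ∫ U, F U ∂haar d L₀ L G =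
      ∫ p : Config d L₀ L G × Config d L₀ L G, F (mulOn C p.2 p.1)
        ∂(haar d L₀ L G).prod (haar d L₀ L G) := by
  have hm : Measurable fun p : Config d L₀ L G × Config d L₀ L G => mulOn C p.2 p.1 := by
    refine measurable_pi_lambda _ fun e => ?_
    simp only [mulOn]
    split_ifs
    · exact ((measurable_pi_apply e).comp measurable_snd).mul
        ((measurable_pi_apply e).comp measurable_fst)
    · exact measurable_const.mul ((measurable_pi_apply e).comp measurable_fst)
  have hi : Integrable (fun p : Config d L₀ L G × Config d L₀ L G => F (mulOn C p.2 p.1))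
      ((haar d L₀ L G).prod (haar d L₀ L G)) :=
    Integrable.of_bound (hFm.comp hm).aestronglyMeasurable K (ae_of_all _ fun p => hFb _)
  rw [integral_prod_symm _ hi]
  have hY : ∀ Y : Config d L₀ L G, ∫ U, F (mulOn C Y U) ∂haar d L₀ L G = ∫ U, F U ∂haar d L₀ L G :=
    fun Y => Literature.MathematicalPhysics.QuantumFieldTheory.LatticeRP.integral_comp_eq_of_measurePreserving
      (measurePreserving_mulOn C Y) hFm
  simp_rw [hY]
  rw [integral_const, probReal_univ, one_smul]

/-! ### Sums over `ℤ_{L₀}` split at the reflection planes -/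

omit [TopologicalSpace G] [IsTopologicalGroup G] [CompactSpace G] [MeasurableSpace G]
  [BorelSpace G] [SecondCountableTopology G] [Group G] in
/-- `Σ_{t ∈ ℤ_{n+1}} f t = Σ_{k < n+1} f k`. [folklore] -/
theorem sum_zmod_eq_sum_range {M : Type*} [AddCommMonoid M] (n : ℕ) (f : ZMod (n + 1) → M) :
    ∑ t, f t = ∑ k ∈ Finset.range (n + 1), f k := by
  rw [← Fin.sum_univ_eq_sum_range]
  refine Fintype.sum_congr _ _ fun i => ?_
  congr 1
  exact (ZMod.natCast_zmod_val i).symm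

omit [TopologicalSpace G] [IsTopologicalGroup G] [CompactSpace G] [MeasurableSpace G]
  [BorelSpace G] [SecondCountableTopology G] [Group G] in
/-- **Odd period, split for the magnetic slices** (`ℤ_{2m+1} = {0} ⊔ {1..m} ⊔ −{1..m}`):
`Σ_t f t = f 0 + Σ_{j<m} (f (j+1) + f (−(j+1)))`. [folklore] -/
theorem sum_zmod_odd_split_neg {M : Type*} [AddCommMonoid M] (m : ℕ) (f : ZMod (2 * m + 1) → M) :
    ∑ t, f t = f 0 + ∑ j ∈ Finset.range m, (f ((j + 1 : ℕ) : ZMod (2 * m + 1)) +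
      f (-((j + 1 : ℕ) : ZMod (2 * m + 1)))) := by
  rw [sum_zmod_eq_sum_range (2 * m) f, Finset.sum_add_distrib]
  have h1 : Finset.range (2 * m + 1) = {0} ∪ Finset.Ico 1 (m + 1) ∪ Finset.Ico (m + 1) (2 * m + 1) := by
    ext k; simp only [Finset.mem_range, Finset.mem_union, Finset.mem_singleton, Finset.mem_Ico]; omega
  rw [h1, Finset.sum_union (by
      rw [Finset.disjoint_left]; intro k hk
      simp only [Finset.mem_union, Finset.mem_singleton, Finset.mem_Ico] at hk ⊢; omega),
    Finset.sum_union (by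
      rw [Finset.disjoint_left]; intro k hk
      simp only [Finset.mem_singleton, Finset.mem_Ico] at hk ⊢; omega),
    Finset.sum_singleton, Nat.cast_zero, add_assoc]
  congr 1
  rw [Finset.sum_Ico_eq_sum_range, Finset.sum_Ico_eq_sum_range]
  simp only [show m + 1 - 1 = m by omega, show 2 * m + 1 - (m + 1) = m by omega]
  congr 1
  · exact Finset.sum_congr rfl fun j _ => by rw [Nat.add_comm 1 j]
  · rw [← Finset.sum_range_reflect]
    refine Finset.sum_congr rfl fun j hj => ?_
    have hj' := Finset.mem_range.1 hj
    congr 1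
    have hc : (m + 1 + (m - 1 - j) : ℕ) = 2 * m - j := by omega
    rw [hc]
    have h0 : ((2 * m + 1 : ℕ) : ZMod (2 * m + 1)) = 0 := ZMod.natCast_self _
    have h2 : ((2 * m - j : ℕ) : ZMod (2 * m + 1)) + ((j + 1 : ℕ) : ZMod (2 * m + 1)) = 0 := by
      rw [← Nat.cast_add, show 2 * m - j + (j + 1) = 2 * m + 1 by omega, h0]
    exact eq_neg_of_add_eq_zero_left h2

omit [TopologicalSpace G] [IsTopologicalGroup G] [CompactSpace G] [MeasurableSpace G]
  [BorelSpace G] [SecondCountableTopology G] [Group G] in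
/-- **Odd period, split for the electric slices** (`ℤ_{2m+1} = {0..m-1} ⊔ {m} ⊔ (−1 − {0..m-1})`):
`Σ_t f t = Σ_{j<m} (f j + f (−1−j)) + f m`. [folklore] -/
theorem sum_zmod_odd_split_elec {M : Type*} [AddCommMonoid M] (m : ℕ) (f : ZMod (2 * m + 1) → M) :
    ∑ t, f t = ∑ j ∈ Finset.range m, (f (j : ZMod (2 * m + 1)) + f (-1 - (j : ZMod (2 * m + 1)))) +
      f (m : ZMod (2 * m + 1)) := by
  rw [sum_zmod_eq_sum_range (2 * m) f, Finset.sum_add_distrib]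
  have h1 : Finset.range (2 * m + 1) = Finset.range m ∪ {m} ∪ Finset.Ico (m + 1) (2 * m + 1) := by
    ext k; simp only [Finset.mem_range, Finset.mem_union, Finset.mem_singleton, Finset.mem_Ico]; omega
  rw [h1, Finset.sum_union (by
      rw [Finset.disjoint_left]; intro k hk
      simp only [Finset.mem_union, Finset.mem_singleton, Finset.mem_Ico, Finset.mem_range] at hk ⊢
      omega),
    Finset.sum_union (by
      rw [Finset.disjoint_left]; intro k hk
      simp only [Finset.mem_singleton, Finset.mem_range] at hk ⊢; omega),
    Finset.sum_singleton]
  rw [add_assoc, add_comm (f (m : ZMod (2 * m + 1))), ← add_assoc]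
  congr 2
  rw [Finset.sum_Ico_eq_sum_range, show 2 * m + 1 - (m + 1) = m by omega,
    ← Finset.sum_range_reflect]
  refine Finset.sum_congr rfl fun j hj => ?_
  have hj' := Finset.mem_range.1 hj
  congr 1
  have hc : (m + 1 + (m - 1 - j) : ℕ) = 2 * m - j := by omega
  rw [hc]
  have h0 : ((2 * m + 1 : ℕ) : ZMod (2 * m + 1)) = 0 := ZMod.natCast_self _
  have h2 : ((2 * m - j : ℕ) : ZMod (2 * m + 1)) + 1 + (j : ZMod (2 * m + 1)) = 0 := by
    have : ((2 * m - j : ℕ) : ZMod (2 * m + 1)) + 1 + (j : ZMod (2 * m + 1)) =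
        ((2 * m - j + 1 + j : ℕ) : ZMod (2 * m + 1)) := by push_cast; ring
    rw [this, show 2 * m - j + 1 + j = 2 * m + 1 by omega, h0]
  have := eq_neg_of_add_eq_zero_left (show ((2 * m - j : ℕ) : ZMod (2 * m + 1)) +
    (1 + (j : ZMod (2 * m + 1))) = 0 by rwa [← add_assoc])
  rw [this]; ring

omit [TopologicalSpace G] [IsTopologicalGroup G] [CompactSpace G] [MeasurableSpace G]
  [BorelSpace G] [SecondCountableTopology G] [Group G] in
/-- **Even period, split for the magnetic slices** (`ℤ_{2n+2} = {0, n+1} ⊔ {1..n} ⊔ −{1..n}`):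
`Σ_t f t = f 0 + f (n+1) + Σ_{j<n} (f (j+1) + f (−(j+1)))`. [folklore] -/
theorem sum_zmod_even_split_neg {M : Type*} [AddCommMonoid M] (n : ℕ) (f : ZMod (2 * n + 2) → M) :
    ∑ t, f t = f 0 + f ((n + 1 : ℕ) : ZMod (2 * n + 2)) + ∑ j ∈ Finset.range n,
      (f ((j + 1 : ℕ) : ZMod (2 * n + 2)) + f (-((j + 1 : ℕ) : ZMod (2 * n + 2)))) := by
  rw [sum_zmod_eq_sum_range (2 * n + 1) f, Finset.sum_add_distrib]
  have h1 : Finset.range (2 * n + 1 + 1) =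
      {0} ∪ {n + 1} ∪ Finset.Ico 1 (n + 1) ∪ Finset.Ico (n + 2) (2 * n + 2) := by
    ext k
    simp only [Finset.mem_range, Finset.mem_union, Finset.mem_singleton, Finset.mem_Ico]
    omega
  rw [h1, Finset.sum_union (by
      rw [Finset.disjoint_left]; intro k hk
      simp only [Finset.mem_union, Finset.mem_singleton, Finset.mem_Ico] at hk ⊢; omega),
    Finset.sum_union (by
      rw [Finset.disjoint_left]; intro k hk
      simp only [Finset.mem_union, Finset.mem_singleton, Finset.mem_Ico] at hk ⊢; omega),
    Finset.sum_union (by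
      rw [Finset.disjoint_left]; intro k hk
      simp only [Finset.mem_singleton] at hk ⊢; omega),
    Finset.sum_singleton, Finset.sum_singleton, Nat.cast_zero, add_assoc]
  congr 1
  rw [Finset.sum_Ico_eq_sum_range, Finset.sum_Ico_eq_sum_range]
  simp only [show n + 1 - 1 = n by omega, show 2 * n + 2 - (n + 2) = n by omega]
  congr 1
  · exact Finset.sum_congr rfl fun j _ => by rw [Nat.add_comm 1 j]
  · rw [← Finset.sum_range_reflect]
    refine Finset.sum_congr rfl fun j hj => ?_
    have hj' := Finset.mem_range.1 hj
    congr 1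
    have hc : (n + 2 + (n - 1 - j) : ℕ) = 2 * n + 1 - j := by omega
    rw [hc]
    have h0 : ((2 * n + 2 : ℕ) : ZMod (2 * n + 2)) = 0 := ZMod.natCast_self _
    have h2 : ((2 * n + 1 - j : ℕ) : ZMod (2 * n + 2)) + ((j + 1 : ℕ) : ZMod (2 * n + 2)) = 0 := by
      rw [← Nat.cast_add, show 2 * n + 1 - j + (j + 1) = 2 * n + 2 by omega, h0]
    exact eq_neg_of_add_eq_zero_left h2

omit [TopologicalSpace G] [IsTopologicalGroup G] [CompactSpace G] [MeasurableSpace G]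
  [BorelSpace G] [SecondCountableTopology G] [Group G] in
/-- **Even period, split for the electric slices** (`ℤ_{2n+2} = {0..n} ⊔ (−1 − {0..n})`):
`Σ_t f t = Σ_{j<n+1} (f j + f (−1−j))`. [folklore] -/
theorem sum_zmod_even_split_elec {M : Type*} [AddCommMonoid M] (n : ℕ) (f : ZMod (2 * n + 2) → M) :
    ∑ t, f t = ∑ j ∈ Finset.range (n + 1),
      (f (j : ZMod (2 * n + 2)) + f (-1 - (j : ZMod (2 * n + 2)))) := by
  rw [sum_zmod_eq_sum_range (2 * n + 1) f, Finset.sum_add_distrib]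
  have h1 : Finset.range (2 * n + 1 + 1) = Finset.range (n + 1) ∪ Finset.Ico (n + 1) (2 * n + 2) := by
    ext k; simp only [Finset.mem_range, Finset.mem_union, Finset.mem_Ico]; omega
  rw [h1, Finset.sum_union (by
      rw [Finset.disjoint_left]; intro k hk
      simp only [Finset.mem_Ico, Finset.mem_range] at hk ⊢; omega)]
  congr 1
  rw [Finset.sum_Ico_eq_sum_range, show 2 * n + 2 - (n + 1) = n + 1 by omega,
    ← Finset.sum_range_reflect]
  refine Finset.sum_congr rfl fun j hj => ?_
  have hj' := Finset.mem_range.1 hj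
  congr 1
  have hc : (n + 1 + (n + 1 - 1 - j) : ℕ) = 2 * n + 1 - j := by omega
  rw [hc]
  have h0 : ((2 * n + 2 : ℕ) : ZMod (2 * n + 2)) = 0 := ZMod.natCast_self _
  have h2 : ((2 * n + 1 - j : ℕ) : ZMod (2 * n + 2)) + (1 + (j : ZMod (2 * n + 2))) = 0 := by
    have : ((2 * n + 1 - j : ℕ) : ZMod (2 * n + 2)) + (1 + (j : ZMod (2 * n + 2))) =
        ((2 * n + 1 - j + 1 + j : ℕ) : ZMod (2 * n + 2)) := by push_cast; ring
    rw [this, show 2 * n + 1 - j + 1 + j = 2 * n + 2 by omega, h0]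
  rw [eq_neg_of_add_eq_zero_left h2]
  ring

end FiniteTemperature

end Literature.Barriers.QuantumFields

end
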